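import Summits.FinalStateConjecture.FinalStateConjecture.Theorems.EIHFluxBalanceInertialRecessionRechartClockHolePackages
import Summits.FinalStateConjecture.FinalStateConjecture.Theorems.EIHFluxBalanceInertialRecessionRechartClockTransferClauses
import Summits.FinalStateConjecture.FinalStateConjecture.Theorems.EIHFluxBalanceInertialRecessionRechartAssemblyCoreSpin
import Summits.FinalStateConjecture.FinalStateConjecture.Theorems.EIHFluxBalanceInertialRecessionRechartTransfer3
import Summits.FinalStateConjecture.FinalStateConjecture.Theorems.EIHFluxBalanceInertialRecessionRechartStatic
import Summits.FinalStateConjecture.FinalStateConjecture.Theorems.EIHFluxBalanceInertialRecessionRechartMesh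
import Summits.FinalStateConjecture.FinalStateConjecture.Theorems.EIHFluxBalanceInertialRecessionRechartOrientation
import Summits.FinalStateConjecture.FinalStateConjecture.Theorems.EIHFluxBalanceInertialRecessionLateChart
import Summits.FinalStateConjecture.FinalStateConjecture.Theorems.EIHFluxBalanceInertialRecessionStubRechart3Flat
import Summits.FinalStateConjecture.FinalStateConjecture.Theorems.EIHFluxBalanceInertialRecessionStubRechart3Disjoint
import Summits.FinalStateConjecture.FinalStateConjecture.Theorems.EIHFluxBalanceInertialRecessionStubRechart3G1

/-!
# Route EIHFluxBalance — `InertialRecession`: the RE-CHARTING STUB `stub_rechart` for ALL spins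

Crux `stmt-FinalStateConjecture-10166` (`…Theses.EIHFluxBalance.InertialRecession`), line
`sublinear-is-free-clean-window-charges`, registered stub `stub_rechart` (skeleton r11): antecedent +
`Slaved³` + painted-velocity convergence + eventual lab-time causality ⇒ the crux conclusion, for arbitrary
sub-extremal spins. Proof: orientation (`orientation_of_antecedent`); final velocities `Vᵢ` (`ξ̇ᵢ → Vᵢ`,
Cesàro, `‖Vᵢ‖ ≤ κ² < 1`); clock-chart packages with lab clocks, future orientation and floor-adjusted
certified Carter reach (`clock_hole_packages`); lags `s₀ᵢ := 1 + θᵢ(0)` and final charts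
`ψᵢ(y) = Φ(Aᵢ((boost Vᵢ)⁻¹y))` on the LAGGED backgrounds `boostedKerrBackground (boost Vᵢ) (s₀ᵢ • boost Vᵢ e₀)`;
`clock_transfer_clauses`; the flat package for `R' = max(R₀, g/(4(1+3γ)))` (`g` a continuous minorant of
the ball profile); the transfer `exterior_subset_certified_union_causalPast₃`; lag-shifted eventual
disjointness; convergence transport; `exists_finalStateDecomposition_of_rechart_spin`. [folklore]
-/

noncomputable section

set_option linter.dupNamespace false

open Set Filter Topology Function TopologicalSpace Metric Literature.Geometry.Lorentzian
open Summit.FinalStateConjecture.FinalStateConjecture.Theorems.SublinearIsFree.Rechart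
open scoped Manifold ContDiff ENNReal BigOperators

namespace Summit.FinalStateConjecture.FinalStateConjecture.Theorems

/-- If `ξ` is differentiable with `ξ̇ → V` then `t⁻¹ξ(t) → V` (local copy of the landed lemma, whose
module is broken by the 2026-08-16 `HasExhaustiveCharts` change). [folklore] -/
private theorem tendsto_inv_smul_of_tendsto_deriv' {ξ : ℝ → E3} (hξ : Differentiable ℝ ξ) {V : E3}
    (h : Tendsto (deriv ξ) atTop (𝓝 V)) : Tendsto (fun t : ℝ ↦ t⁻¹ • ξ t) atTop (𝓝 V) := by
  set g : ℝ → E3 := fun t ↦ ξ t - t • V with hg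
  have hgd : ∀ t, HasDerivAt g (deriv ξ t - V) t := fun t ↦
    (hξ t).hasDerivAt.sub ((hasDerivAt_id t).smul_const V |>.congr_deriv (by simp))
  have hg' : Tendsto (fun t ↦ deriv ξ t - V) atTop (𝓝 0) := by
    simpa using h.sub_const V
  rw [Metric.tendsto_atTop]
  intro ε hε
  have hε2 : 0 < ε / 2 := by positivity
  obtain ⟨T₁, hT₁⟩ := (Metric.tendsto_atTop.mp hg') (ε / 2) hε2
  set T : ℝ := max T₁ 1 with hT
  have hT1 : 1 ≤ T := le_max_right _ _
  -- mean value bound on `[T, t]`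
  have hmv : ∀ t, T ≤ t → ‖g t - g T‖ ≤ ε / 2 * (t - T) := by
    intro t ht
    have hb : ∀ s ∈ Icc T t, ‖deriv ξ s - V‖ ≤ ε / 2 := fun s hs ↦ by
      have := hT₁ s ((le_max_left _ _).trans hs.1)
      rw [dist_zero_right] at this
      exact this.le
    have h := Convex.norm_image_sub_le_of_norm_hasDerivWithin_le (f := g)
      (f' := fun s ↦ deriv ξ s - V) (s := Icc T t) (fun s _ ↦ (hgd s).hasDerivWithinAt) hb
      (convex_Icc T t) (left_mem_Icc.mpr ht) (right_mem_Icc.mpr ht)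
    rwa [Real.norm_eq_abs, abs_of_nonneg (sub_nonneg.mpr ht)] at h
  set T₂ : ℝ := max T (2 * ‖g T‖ / ε + 1) with hT₂
  refine ⟨T₂, fun t ht ↦ ?_⟩
  have htT : T ≤ t := (le_max_left _ _).trans ht
  have ht0 : 0 < t := by linarith
  have hgt : ‖g t‖ ≤ ‖g T‖ + ε / 2 * (t - T) := by
    have := hmv t htT
    linarith [norm_le_norm_add_norm_sub' (g t) (g T), norm_sub_rev (g t) (g T)]
  have hkey : t⁻¹ • ξ t - V = t⁻¹ • g t := by
    rw [hg]; simp only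
    rw [smul_sub, smul_smul, inv_mul_cancel₀ ht0.ne', one_smul]
  rw [dist_eq_norm, hkey, norm_smul, Real.norm_eq_abs, abs_of_pos (inv_pos.mpr ht0)]
  rw [inv_mul_lt_iff₀ ht0]
  have h1 : 2 * ‖g T‖ / ε + 1 ≤ t := (le_max_right _ _).trans ht
  have h2 : 2 * ‖g T‖ < ε * t := by
    rw [div_add_one (ne_of_gt hε), div_le_iff₀ hε] at h1
    nlinarith [norm_nonneg (g T)]
  nlinarith [norm_nonneg (g T)]

/-- The slack of a lab clock is nondecreasing, so `slack(t) + (1 + θ 0) ≥ 1` for `t ≥ 0`. [folklore] -/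
theorem one_le_slack_add {θ u : ℝ → ℝ} (hu1 : ∀ t, 1 ≤ u t)
    (hslack : ∀ t, HasDerivAt (fun t ↦ t - θ t) (1 - (u t)⁻¹) t) (t : ℝ) (ht : 0 ≤ t) :
    1 ≤ (t - θ t) + (1 + θ 0) := by
  have hmono : Monotone (fun t ↦ t - θ t) :=
    monotone_of_deriv_nonneg (fun t ↦ (hslack t).differentiableAt) fun t ↦ by
      rw [(hslack t).deriv, sub_nonneg]; exact inv_le_one_of_one_le₀ (hu1 t)
  have h := hmono ht
  simp only at h
  linarith

-- long statement and long bookkeeping proof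
set_option maxHeartbeats 1600000 in
/-- **The re-charting stub for all spins** (registered `stub_rechart` of skeleton r11 of line
`sublinear-is-free-clean-window-charges`). See the module docstring. [folklore] -/
theorem stub_rechart : ∀ (X : Type) [TopologicalSpace X] [ChartedSpace E3 X] [IsManifold (𝓡 3) ((⊤ : ℕ∞) : WithTop ℕ∞) X] [T2Space X] [SecondCountableTopology X] [ConnectedSpace X], ∀ D ∈ admissibleVacuumData X, ∀ 𝒟 : VacuumCauchyDevelopment D, 𝒟.IsMaximal → ∀ (N : ℕ) (M a rin : Fin N → ℝ) (Λ : Fin N → ℝ → lorentzGroup) (ξ : Fin N → ℝ → E3) (γ κ τ₀ : ℝ) (U : Opens E4) (Φ : U → 𝒟.carrier) (O : Set 𝒟.carrier), ((∀ i, Kerr.IsSubextremal (M i) (a i) ∧ Kerr.rMinus (M i) (a i) < rin i ∧ rin i < Kerr.rPlus (M i) (a i)) ∧ (∀ i t, |((Λ i t : E4 ≃L[ℝ] E4) (E4.basisVector 0)) 0| ≤ γ) ∧ (∀ i, ContDiff ℝ ((⊤ : ℕ∞) : WithTop ℕ∞) (ξ i) ∧ ContDiff ℝ ((⊤ : ℕ∞)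 : WithTop ℕ∞) (fun t ↦ ((Λ i t : E4 ≃L[ℝ] E4) : E4 →L[ℝ] E4))) ∧ (∀ i j, i ≠ j → Tendsto (fun t ↦ ‖ξ i t - ξ j t‖) atTop atTop) ∧ (0 < κ ∧ κ < 1 ∧ ∀ i, ∀ᶠ t in atTop, ‖ξ i t‖ ≤ κ ^ 2 * t) ∧ ({x : E4 | τ₀ < x 0 ∧ ∀ i, rin i < Kerr.radius (a i) (poincareInv (Λ i (x 0)) (E4.ofTimeSpace (x 0) (ξ i (x 0))) x)} ⊆ (U : Set E4)) ∧ let B : ModelBackground := ⟨U, fun x ↦ Minkowski.bilin + ∑ i, (boostedKerrBilin (Λ i (x 0)) (E4.ofTimeSpace (x 0) (ξ i (x 0))) (M i) (a i) x - Minkowski.bilin), fun x ↦ x 0, E4.spatialNorm⟩; ContMDiff 𝓘(ℝ, E4) (𝓡 4) ((⊤ : ℕ∞) : WithTop ℕ∞) Φ ∧ Topology.IsOpenEmbedding ((B.lateRegion τ₀).restrict Φ) ∧ Φ '' {x : U | τ₀ < x.1 0 ∧ ∀ i, Kerr.rPlus (M i) (a i) < Kerr.radius (a i) (poincareInv (Λ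 i (x.1 0)) (E4.ofTimeSpace (x.1 0) (ξ i (x.1 0))) x.1)} ⊆ O ∧ Tendsto (fun t ↦ 𝒟.toSpacetime.deviationCk B Φ 3 t) atTop (𝓝 0) ∧ Tendsto (fun t : ℝ ↦ ⨆ x ∈ {x : U | x.1 0 = t ∧ E4.spatialNorm x.1 ≤ κ * t}, ⨆ (m : ℕ) (_ : m ≤ 3), ENNReal.ofReal (1 + √(√((⨅ i, ‖E4.spatial x.1 - ξ i t‖) ^ 7))) * ‖iteratedFDeriv ℝ m (𝒟.toSpacetime.deviationExtend B Φ) x.1‖ₑ) atTop (𝓝 0) ∧ O = Summit.FinalStateConjecture.exteriorOf 𝒟.toCauchyDevelopment (Φ '' {x : U | τ₀ < x.1 0 ∧ ∀ i, Kerr.rPlus (M i) (a i) < Kerr.radius (a i) (poincareInv (Λ i (x.1 0)) (E4.ofTimeSpace (x.1 0) (ξ i (x.1 0))) x.1)}) ∧ ∀ t₁ : ℝ, τ₀ < t₁ → O \ Φ '' {x : U | t₁ < x.1 0 ∧ ∀ i, Kerr.rPlus (M i) (a i) < Kerr.radius (a i) (poincareInv (Λ i (x.1 0)) (E4.ofTimeSpace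 (x.1 0) (ξ i (x.1 0))) x.1)} ⊆ 𝒟.metric.causalPast 𝒟.timeOrientation (Φ '' {x : U | x.1 0 = t₁ ∧ ∀ i, Kerr.rPlus (M i) (a i) < Kerr.radius (a i) (poincareInv (Λ i (x.1 0)) (E4.ofTimeSpace (x.1 0) (ξ i (x.1 0))) x.1)})) → (∀ i : Fin N, (∀ m : ℕ, 1 ≤ m → m ≤ 3 → Tendsto (fun t ↦ iteratedDeriv m (fun s ↦ (((Λ i s : lorentzGroup) : E4 ≃L[ℝ] E4) (E4.basisVector 0))) t) atTop (𝓝 0)) ∧ (∀ m : ℕ, m ≤ 2 → Tendsto (fun t ↦ iteratedDeriv m (fun s ↦ deriv (ξ i) s - (((((Λ i s : lorentzGroup) : E4 ≃L[ℝ] E4) (E4.basisVector 0)) 0)⁻¹ • E4.spatial (((Λ i s : lorentzGroup) : E4 ≃L[ℝ] E4) (E4.basisVector 0)))) t) atTop (𝓝 0)) ∧ (a i ≠ 0 → ∀ m : ℕ, 1 ≤ m → m ≤ 3 → Tendsto (fun t ↦ iteratedDeriv m (fun s ↦ (((Λ i s : lorentzGroup) : E4 ≃L[ℝ] E4) (E4.basisVector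 3))) t) atTop (𝓝 0))) → (∀ i : Fin N, ∃ V : E3, Tendsto (fun t ↦ ((((Λ i t : lorentzGroup) : E4 ≃L[ℝ] E4) (E4.basisVector 0)) 0)⁻¹ • E4.spatial (((Λ i t : lorentzGroup) : E4 ≃L[ℝ] E4) (E4.basisVector 0))) atTop (𝓝 V)) → (∃ τ₁ : ℝ, ∀ x y : U, (τ₁ < x.1 0 ∧ ∀ i, rin i < Kerr.radius (a i) (poincareInv (Λ i (x.1 0)) (E4.ofTimeSpace (x.1 0) (ξ i (x.1 0))) x.1)) → (τ₁ < y.1 0 ∧ ∀ i, rin i < Kerr.radius (a i) (poincareInv (Λ i (y.1 0)) (E4.ofTimeSpace (y.1 0) (ξ i (y.1 0))) y.1)) → Φ y ∈ 𝒟.metric.causalFuture 𝒟.timeOrientation {Φ x} → x.1 0 ≤ y.1 0) → ∃ (O : Set 𝒟.carrier) (d : FinalStateDecomposition 𝒟.toSpacetime O 2), (∀ i, Kerr.IsSubextremal (d.mass i) (d.spin i)) ∧ O = Summit.FinalStateConjecture.exteriorOf 𝒟.toCauchyDevelopment d.charted ∧ Summit.FinalStateConjecture.HasExhaustiveCharts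 d := by
  intro X _ _ _ _ _ _ D hD 𝒟 h𝒟 N M a rin Λ ξ γ κ τ₀ U Φ O hL hS hv hT
  -- orientation of the painted frames
  have hpos : ∀ (i : Fin N) (t : ℝ), 0 < (((Λ i t : lorentzGroup) : E4 ≃L[ℝ] E4) (E4.basisVector 0)) 0 :=
    orientation_of_antecedent X D hD 𝒟 h𝒟 N M a rin Λ ξ γ κ τ₀ U Φ O hL hS hT
  obtain ⟨hsub, hγ, hsm, hsep, hκ, hU, hB⟩ := hL
  obtain ⟨hΦ, hemb, himO, hdev, -, hO, hexh⟩ := hB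
  obtain ⟨τT, hT₁⟩ := hT
  beta_reduce at hsub hU hemb himO hdev hO hexh hT₁
  -- ### final velocities
  have hVel : ∀ i : Fin N, ∃ V : E3, Tendsto (deriv (ξ i)) atTop (𝓝 V) := by
    intro i
    obtain ⟨V, hV⟩ := hv i
    refine ⟨V, ?_⟩
    have hmis : Tendsto (fun t ↦ deriv (ξ i) t - ((((Λ i t : lorentzGroup) : E4 ≃L[ℝ] E4)
        (E4.basisVector 0)) 0)⁻¹ • E4.spatial (((Λ i t : lorentzGroup) : E4 ≃L[ℝ] E4)
          (E4.basisVector 0))) atTop (𝓝 0) := by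
      simpa using (hS i).2.1 0 (Nat.zero_le 2)
    have h := hmis.add hV
    rw [zero_add] at h
    exact h.congr fun t ↦ by simp
  have hCes : ∀ i : Fin N, ∃ V : E3, Tendsto (fun t : ℝ ↦ t⁻¹ • ξ i t) atTop (𝓝 V) := fun i ↦ by
    obtain ⟨V, hV⟩ := hVel i
    exact ⟨V, tendsto_inv_smul_of_tendsto_deriv' ((hsm i).1.differentiable (by simp)) hV⟩
  choose V hV using hCes
  have hVκ : ∀ i, ‖V i‖ ≤ κ ^ 2 := fun i ↦ norm_cesaro_le (hV i) (hκ.2.2 i)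
  have hκ2 : κ ^ 2 < 1 := by nlinarith [hκ.1, hκ.2.1]
  have hV1 : ∀ i, ‖V i‖ < 1 := fun i ↦ (hVκ i).trans_lt hκ2
  -- ### the hole packages with their causal data
  obtain ⟨Λt, T₀, C, A, hAU, θ, Rr, Sr, hΛt, he₀, hdec, hbil, hrad, hT₀c, hclock, hT₀lo, hT₀hi, htop, hAC,
    hAc, hAemb, hlate, hwin, hCle, hC0, hoff, hradii, hhon, hconv, hθT, hTθ, hθm, hθ1, hθc, hθtop, hslack,
    hRrm, hRrtop, hRrfloor, hconvRr, hreach⟩ :=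
    clock_hole_packages 𝒟.toSpacetime M a rin Λ ξ γ τ₀ U Φ hsub hγ hsm hsep hU hΦ hdev hS hpos hT₁
  set γ' : ℝ := max γ 1 with hγ'
  have hγ1 : 1 ≤ γ' := le_max_right _ _
  have hγ0 : 0 ≤ γ' := zero_le_one.trans hγ1
  have huγ : ∀ i t, |((Λt i t : E4 ≃L[ℝ] E4) (E4.basisVector 0)) 0| ≤ γ' := fun i t ↦ by
    rw [he₀]; exact (hγ i t).trans (le_max_left _ _)
  have hpos' : ∀ i t, 0 < ((Λt i t : E4 ≃L[ℝ] E4) (E4.basisVector 0)) 0 := fun i t ↦ by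
    rw [he₀]; exact hpos i t
  have hu1 : ∀ i t, 1 ≤ ((Λt i t : E4 ≃L[ℝ] E4) (E4.basisVector 0)) 0 := fun i t ↦ by
    have h := one_le_abs_lorentz_apply_zero (Λt i t)
    rw [abs_of_pos (hpos' i t)] at h; exact h
  have hmis : ∀ j, ∀ m : ℕ, m ≤ 2 → Tendsto (fun t ↦ iteratedDeriv m (fun s ↦ deriv (ξ j) s -
      ((((Λt j s : E4 ≃L[ℝ] E4) (E4.basisVector 0)) 0)⁻¹ •
        E4.spatial ((Λt j s : E4 ≃L[ℝ] E4) (E4.basisVector 0)))) t) atTop (𝓝 0) := by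
    intro j m hm
    have h := (hS j).2.1 m hm
    simp only [he₀]
    exact h
  have hξ : ∀ j, ContDiff ℝ ∞ (ξ j) := fun j ↦ (hsm j).1
  have hrp0 : ∀ i, 0 < Kerr.rPlus (M i) (a i) := fun i ↦ (rPlus_facts (hsub i).1).1
  -- ### lags, final motions and final charts
  set s₀ : Fin N → ℝ := fun i ↦ 1 + θ i 0 with hs₀
  have hs₀' : ∀ i t, 0 ≤ t → 1 ≤ (t - θ i t) + s₀ i := fun i t ht ↦ one_le_slack_add (hu1 i) (hslack i) t ht
  set Λf : Fin N → lorentzGroup := fun i ↦ Lorentz.boost (V i) (hV1 i) with hΛf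
  set cm : Fin N → E4 := fun i ↦ s₀ i • (Λf i : E4 ≃L[ℝ] E4) (E4.basisVector 0) with hcm
  set A' : Fin N → E4 → E4 := fun i w ↦ A i ((Λf i : E4 ≃L[ℝ] E4).symm w) with hA'
  have hAU' : ∀ i, ∀ w ∈ (boostedKerrBackground (Λf i) (cm i) (M i) (a i)).domain, A' i w ∈ U :=
    fun i w hw ↦ hAU i _ (symm_mem_rest_of_mem_lag (Λf i) (s₀ i) (M i) (a i) hw)
  have hA'c : ∀ i, ContDiff ℝ ∞ (A' i) := fun i ↦ (hAc i).comp (Λf i : E4 ≃L[ℝ] E4).symm.contDiff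
  have hψ : ∀ i (y : (boostedKerrBackground (Λf i) (cm i) (M i) (a i)).domain),
      (fun y : (boostedKerrBackground (Λf i) (cm i) (M i) (a i)).domain ↦ Φ ⟨A' i y.1, hAU' i y.1 y.2⟩) y =
        Φ ⟨A i ((Λf i : E4 ≃L[ℝ] E4).symm y.1), hAU i _ (symm_mem_rest_of_mem_lag (Λf i) (s₀ i) (M i) (a i) y.2)⟩ :=
    fun i y ↦ rfl
  have hembΦ : IsOpenEmbedding (({x : U | τ₀ < x.1 0} : Set U).restrict Φ) := hemb
  have hinj : ∀ x x' : U, τ₀ < x.1 0 → τ₀ < x'.1 0 → Φ x = Φ x' → x = x' := by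
    intro x x' hx hx' h
    have := hembΦ.injective (a₁ := ⟨x, hx⟩) (a₂ := ⟨x', hx'⟩) h
    exact congrArg Subtype.val this
  have hlate₀ : ∀ i z, τ₀ < A i z 0 := fun i z ↦ (le_max_left _ _).trans_lt (hlate i z)
  -- ### the profile-dependent transfer hypotheses
  obtain ⟨Rb, β, Tc, S, τm, T₂, hRbm, hRbtop, hRb0, hRbdiv, hβ0, hTc0, hTcm, hcov, hT₂, hmesh, hzone, hRz,
    hlab, hstat⟩ := clock_transfer_clauses M a (fun i ↦ (hsub i).1) Λ Λt ξ T₀ A C U Φ hAU Λf s₀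
      (fun i y ↦ Φ ⟨A' i y.1, hAU' i y.1 y.2⟩) (fun i y ↦ rfl) hγ1 hrad hΛt huγ hpos' hdec hT₀c hT₀lo hhon
      (fun i ↦ (hAemb i).injective) hAC hCle hlate₀ hinj θ hθT hθm hθ1 hθtop hslack
      (Ts := 0) hs₀' Rr hRrm hRrtop Sr hreach
  -- ### the flat profile and the flat package
  obtain ⟨g, hgc, hgtop, hgle⟩ := exists_continuous_minorant hRbm hRbtop
  set R₀ : ℝ := 1 + ∑ i, |rin i| + ∑ i, |a i| + ∑ i, Kerr.rPlus (M i) (a i) with hR₀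
  set cγ : ℝ := 1 + 3 * γ' with hcγ
  have hcγ1 : 1 ≤ cγ := by rw [hcγ]; linarith
  have hR₀1 : 1 ≤ R₀ := by
    rw [hR₀]
    have h1 : 0 ≤ ∑ i, |rin i| := Finset.sum_nonneg fun i _ ↦ abs_nonneg _
    have h2 : 0 ≤ ∑ i, |a i| := Finset.sum_nonneg fun i _ ↦ abs_nonneg _
    have h3 : 0 ≤ ∑ i, Kerr.rPlus (M i) (a i) := Finset.sum_nonneg fun i _ ↦ (hrp0 i).le
    linarith
  set R' : ℝ → ℝ := fun t ↦ max R₀ (g t / (4 * cγ)) with hR'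
  have hR'c : Continuous R' := continuous_const.max (hgc.div_const _)
  have hR'R₀ : ∀ t, 1 + ∑ i, |rin i| + ∑ i, |a i| + ∑ i, Kerr.rPlus (M i) (a i) ≤ R' t := fun t ↦ le_max_left _ _
  have hR'R₀' : ∀ t, 1 + ∑ i, |rin i| + ∑ i, |a i| ≤ R' t := fun t ↦ by
    have h3 : 0 ≤ ∑ i, Kerr.rPlus (M i) (a i) := Finset.sum_nonneg fun i _ ↦ (hrp0 i).le
    linarith [hR'R₀ t]
  have hR'top : Tendsto R' atTop atTop :=
    tendsto_atTop_mono (fun t ↦ le_max_right _ _) (hgtop.atTop_div_const (by positivity))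
  have hR'div : Tendsto (fun t ↦ R' t / t) atTop (𝓝 0) := by
    have hup : Tendsto (fun t ↦ R₀ / t + Rb t / t) atTop (𝓝 0) := by
      have h1 : Tendsto (fun t : ℝ ↦ R₀ / t) atTop (𝓝 0) := tendsto_const_nhds.div_atTop tendsto_id
      simpa using h1.add hRbdiv
    refine tendsto_of_tendsto_of_tendsto_of_le_of_le' tendsto_const_nhds hup ?_ ?_
    · filter_upwards [eventually_gt_atTop 0] with t ht
      exact div_nonneg (le_trans (by linarith) (le_max_left _ _)) ht.le
    · filter_upwards [eventually_gt_atTop 0] with t ht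
      rw [← add_div]
      refine div_le_div_of_nonneg_right (max_le (by linarith [hRb0 t]) ?_) ht.le
      have h1 : g t / (4 * cγ) ≤ Rb t / (4 * cγ) := div_le_div_of_nonneg_right (hgle t) (by positivity)
      have h2 : Rb t / (4 * cγ) ≤ Rb t := by
        rw [div_le_iff₀ (by positivity)]; nlinarith [hRb0 t]
      linarith
  set Bf : ModelBackground := ⟨U, fun x ↦ Minkowski.bilin +
      ∑ i, (boostedKerrBilin (Λ i (x 0)) (E4.ofTimeSpace (x 0) (ξ i (x 0))) (M i) (a i) x -
        Minkowski.bilin), fun x ↦ x 0, E4.spatialNorm⟩ with hBf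
  have hdev2 : Tendsto (fun t ↦ 𝒟.toSpacetime.deviationCk Bf Φ 2 t) atTop (𝓝 0) :=
    tendsto_of_tendsto_of_tendsto_of_le_of_le tendsto_const_nhds hdev (fun _ ↦ bot_le)
      fun t ↦ 𝒟.toSpacetime.deviationCk_mono Bf Φ (by norm_num) t
  obtain ⟨U₀, hU₀, ρ, hU₀eq, hρ, htube, hflat, hembf⟩ := flat_radiationZone_package_general 𝒟.toSpacetime M a
    rin Λ Λt ξ τ₀ U Φ hΦ hU hemb hdev2 hbil hΛt hdec hγ1 huγ hpos' hξ hmis V hV1 hV hR'c hR'R₀' hR'top hR'div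
  obtain ⟨tsp, htsp⟩ : ∃ tsp : ℝ, ∀ t, tsp ≤ t → cγ * R₀ ≤ Rb t :=
    eventually_atTop.mp (hRbtop.eventually (eventually_ge_atTop _))
  have hsplitb : ∀ t, tsp ≤ t → cγ * R' t ≤ Rb t := by
    intro t ht
    rw [hR']; simp only
    rcases le_total R₀ (g t / (4 * cγ)) with h | h
    · rw [max_eq_right h]
      have : cγ * (g t / (4 * cγ)) = g t / 4 := by field_simp
      rw [this]; linarith [hgle t, hRb0 t]
    · rw [max_eq_left h]; exact htsp t ht
  -- ### the common late time
  set τ₀' : ℝ := max (max τm (max τ₀ 0 + 2)) (max tsp τT + 1) with hτ₀'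
  have hτmle : τm ≤ τ₀' := (le_max_left _ _).trans (le_max_left _ _)
  have hτ0 : max τ₀ 0 + 2 ≤ τ₀' := (le_max_right _ _).trans (le_max_left _ _)
  have hτ : τ₀ < τ₀' := by
    have := le_max_left τ₀ 0; linarith
  have hτT : τT < τ₀' := by
    have h1 : max tsp τT + 1 ≤ τ₀' := le_max_right _ _
    have h2 := le_max_right tsp τT; linarith
  have htsp' : tsp ≤ τ₀' := by
    have h1 : max tsp τT + 1 ≤ τ₀' := le_max_right _ _
    have h2 := le_max_left tsp τT; linarith
  have hTc : Tc ≤ τ₀' := hTcm.trans hτmle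
  -- ### the transfer
  have hrpc : ∀ i, Continuous fun x : U ↦ Kerr.radius (a i)
      (poincareInv (Λ i (x.1 0)) (E4.ofTimeSpace (x.1 0) (ξ i (x.1 0))) x.1) := fun i ↦
    (continuous_paintedRadius (a i) (Λ i) (ξ i) (hsm i).2.continuous (hsm i).1.continuous).comp
      continuous_subtype_val
  have hWo : IsOpen (Φ '' {x : U | τ₀ < x.1 0 ∧ ∀ j, Kerr.rPlus (M j) (a j) < Kerr.radius (a j)
      (poincareInv (Λ j (x.1 0)) (E4.ofTimeSpace (x.1 0) (ξ j (x.1 0))) x.1)}) :=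
    isOpen_image_late_of_continuous hembΦ (fun j (x : U) ↦ Kerr.radius (a j)
      (poincareInv (Λ j (x.1 0)) (E4.ofTimeSpace (x.1 0) (ξ j (x.1 0))) x.1)) hrpc fun j ↦ Kerr.rPlus (M j) (a j)
  have hOcl : ∀ p ∈ O, ∀ z : 𝒟.carrier, z ∈ 𝒟.metric.causalFuture 𝒟.timeOrientation {p} →
      z ∈ 𝒟.metric.causalPast 𝒟.timeOrientation (Φ '' {x : U | τ₀ < x.1 0 ∧ ∀ j, Kerr.rPlus (M j) (a j) <
        Kerr.radius (a j) (poincareInv (Λ j (x.1 0)) (E4.ofTimeSpace (x.1 0) (ξ j (x.1 0))) x.1)}) → z ∈ O :=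
    fun p hp z hz hzW ↦ mem_exterior_of_causalFuture_of_causalPast 𝒟 hWo hO hp hz hzW
  have hψemb : ∀ i, IsOpenEmbedding (fun y : (boostedKerrBackground (Λf i) (cm i) (M i) (a i)).domain ↦
      Φ ⟨A' i y.1, hAU' i y.1 y.2⟩) := fun i ↦
    isOpenEmbedding_finalChart (Λf i) (s₀ i) (M i) (a i) U Φ (A i) (hAU i)
      (fun y : (boostedKerrBackground (Λf i) (cm i) (M i) (a i)).domain ↦ Φ ⟨A' i y.1, hAU' i y.1 y.2⟩) (hψ i)
      hembΦ (hAemb i) (hlate₀ i)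
  have hKtr : ∀ i, Continuous (boostedKerrBackground (Λf i) (cm i) (M i) (a i)).time ∧
      Continuous (boostedKerrBackground (Λf i) (cm i) (M i) (a i)).radius := fun i ↦
    continuous_lag_time_radius (Λf i) (s₀ i) (M i) (a i)
  have htransfer := fun (τ₁ : ℝ) (hτ₁ : τ₀' ≤ τ₁) ↦ exterior_subset_certified_union_causalPast₃ U Φ O
    (fun x : U ↦ ∀ j, Kerr.rPlus (M j) (a j) < Kerr.radius (a j)
      (poincareInv (Λ j (x.1 0)) (E4.ofTimeSpace (x.1 0) (ξ j (x.1 0))) x.1))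
    (fun i (x : U) ↦ Kerr.radius (a i) (poincareInv (Λ i (x.1 0)) (E4.ofTimeSpace (x.1 0) (ξ i (x.1 0))) x.1))
    (fun i ↦ Kerr.rPlus (M i) (a i)) (fun _ ↦ (1 : ℝ)) (fun i ↦ Kerr.rPlus (M i) (a i) + 2)
    (fun i ↦ boostedKerrBackground (Λf i) (cm i) (M i) (a i))
    (fun i y ↦ Φ ⟨A' i y.1, hAU' i y.1 y.2⟩) (fun i τ ↦ Rr i (τ + s₀ i))
    (fun i τ τ' h ↦ hRrm i (by linarith)) U₀ hU₀ Rb T₂ (fun i t ↦ θ i t - s₀ i) β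
    (τ₀ := τ₀) (τ₀' := τ₀') (τT := τT) (Tc := Tc) (S := S) hτ hτT hTc hβ0 hexh
    (fun x x' hx hxP hx' hx'P h ↦ hT₁ x x' ⟨hx, fun i ↦ (hsub i).2.2.trans (hxP i)⟩
      ⟨hx', fun i ↦ (hsub i).2.2.trans (hx'P i)⟩ h)
    hOcl himO hembΦ hrpc hψemb (fun i ↦ (hKtr i).1) (fun i ↦ (hKtr i).2) hlab
    (fun x hx hxP ↦ ?hsplit) (fun x i hxP ↦ hxP i) (fun i t ht ↦ hRz i t (hτmle.trans ht)) (fun i ↦ by linarith)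
    (fun i y τ₁' hτ₁' ↦ hstat i y τ₁' (hτmle.trans hτ₁')) hcov hT₂ (fun i t ht ↦ hmesh i t (hτmle.trans ht))
    (fun i t ht ↦ hzone i t (hτmle.trans ht)) τ₁ hτ₁
  case hsplit =>
    by_cases hxU : x.1 ∈ (U₀ : Set E4)
    · exact Or.inl hxU
    right
    rw [hU₀eq] at hxU
    simp only [mem_setOf_eq, not_and, not_forall, not_lt] at hxU
    obtain ⟨i, hi⟩ := hxU (by linarith [le_max_left τ₀ 0, le_max_right τ₀ 0])
    refine ⟨i, ?_⟩
    have h1 := radius_poincareInv_le_dist_line (Λ i (x.1 0)) (E4.ofTimeSpace (x.1 0) (ξ i (x.1 0))) x.1 (a i)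
    rw [E4.ofTimeSpace_apply_zero, E4.spatial_ofTimeSpace, sub_self, zero_smul, add_zero] at h1
    have h2 : 1 + 3 * |((Λ i (x.1 0) : E4 ≃L[ℝ] E4) (E4.basisVector 0)) 0| ≤ cγ := by
      rw [hcγ]; linarith [(hγ i (x.1 0)).trans (le_max_left γ 1)]
    have h3 := hsplitb (x.1 0) (htsp'.trans hx)
    calc Kerr.radius (a i) (poincareInv (Λ i (x.1 0)) (E4.ofTimeSpace (x.1 0) (ξ i (x.1 0))) x.1)
        ≤ (1 + 3 * |((Λ i (x.1 0) : E4 ≃L[ℝ] E4) (E4.basisVector 0)) 0|) * ‖E4.spatial x.1 - ξ i (x.1 0)‖ := h1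
      _ ≤ cγ * R' (x.1 0) := mul_le_mul h2 hi (norm_nonneg _) (by positivity)
      _ ≤ Rb (x.1 0) := h3
  -- ### near-zone convergence of the final charts (every radius, and along the certified radii)
  have hΨA : ∀ i, ContMDiff 𝓘(ℝ, E4) (𝓡 4) ∞ (fun z : boostedKerrExterior 1 0 (M i) (a i) ↦ Φ ⟨A i z.1, hAU i z.1 z.2⟩) :=
    fun i ↦ contMDiff_comp_smooth (Ω := boostedKerrExterior 1 0 (M i) (a i)) (hAc i) (hAU i) (fun _ ↦ rfl) hΦ
  have hconvR' : ∀ (i : Fin N) (R : ℝ), Tendsto (fun τ ↦ 𝒟.toSpacetime.truncDeviationCk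
      (boostedKerrBackground (Λf i) (cm i) (M i) (a i))
      (fun y ↦ Φ ⟨A' i y.1, hAU' i y.1 y.2⟩) 2 R τ) atTop (𝓝 0) := fun i R ↦
    tendsto_truncDeviationCk_lag (Λf i) (s₀ i) (M i) (a i)
      (fun z : boostedKerrExterior 1 0 (M i) (a i) ↦ Φ ⟨A i z.1, hAU i z.1 z.2⟩)
      (fun y : (boostedKerrBackground (Λf i) (cm i) (M i) (a i)).domain ↦ Φ ⟨A' i y.1, hAU' i y.1 y.2⟩)
      (hψ i) (hΨA i) 2 (fun _ ↦ R) (hconv i R)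
  have hRc : ∀ i, Tendsto (fun τ ↦ 𝒟.toSpacetime.truncDeviationCk
      (boostedKerrBackground (Λf i) (cm i) (M i) (a i))
      (fun y ↦ Φ ⟨A' i y.1, hAU' i y.1 y.2⟩) 2 (Rr i (τ + s₀ i)) τ) atTop (𝓝 0) := fun i ↦
    tendsto_truncDeviationCk_lag (Λf i) (s₀ i) (M i) (a i)
      (fun z : boostedKerrExterior 1 0 (M i) (a i) ↦ Φ ⟨A i z.1, hAU i z.1 z.2⟩)
      (fun y : (boostedKerrBackground (Λf i) (cm i) (M i) (a i)).domain ↦ Φ ⟨A' i y.1, hAU' i y.1 y.2⟩)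
      (hψ i) (hΨA i) 2 (Rr i) (hconvRr i)
  have hRctop : ∀ i, Tendsto (fun τ ↦ Rr i (τ + s₀ i)) atTop atTop := fun i ↦
    (hRrtop i).comp (tendsto_atTop_add_const_right atTop (s₀ i) tendsto_id)
  have hRcfloor : ∀ i τ, max (Kerr.rPlus (M i) (a i)) 0 + 1 ≤ Rr i (τ + s₀ i) := fun i τ ↦ by
    rw [max_eq_left (hrp0 i).le]; linarith [hRrfloor i (τ + s₀ i)]
  -- ### eventual disjointness of the truncated near zones
  have hdisj : ∀ Rd : ℝ, ∃ τ₁ : ℝ, Pairwise (Function.onFun Disjoint fun i ↦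
      (fun y : (boostedKerrBackground (Λf i) (cm i) (M i) (a i)).domain ↦ Φ ⟨A' i y.1, hAU' i y.1 y.2⟩) ''
        (boostedKerrBackground (Λf i) (cm i) (M i) (a i)).truncLateRegion τ₁ Rd) := by
    intro Rd
    refine exists_pairwise_disjoint_of_eventually _ fun i j hij ↦ ?_
    have himg : ∀ (k : Fin N) (τ : ℝ),
        (fun y : (boostedKerrBackground (Λf k) (cm k) (M k) (a k)).domain ↦ Φ ⟨A' k y.1, hAU' k y.1 y.2⟩) ''
          (boostedKerrBackground (Λf k) (cm k) (M k) (a k)).truncLateRegion τ Rd =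
        boostChart (Λf k) (M k) (a k) (fun z : boostedKerrExterior 1 0 (M k) (a k) ↦ Φ ⟨A k z.1, hAU k z.1 z.2⟩) ''
          (boostedKerrBackground (Λf k) 0 (M k) (a k)).truncLateRegion (τ + s₀ k) Rd := by
      intro k τ
      have h := image_lagChart_eq_boostChart (Λf k) (s₀ k) (M k) (a k)
        (fun z : boostedKerrExterior 1 0 (M k) (a k) ↦ Φ ⟨A k z.1, hAU k z.1 z.2⟩)
        (fun y : (boostedKerrBackground (Λf k) (cm k) (M k) (a k)).domain ↦ Φ ⟨A' k y.1, hAU' k y.1 y.2⟩) (hψ k)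
        (fun t r ↦ τ < t ∧ r ≤ Rd)
      refine Eq.trans rfl (h.trans (congrArg (Set.image _) (Set.ext fun y ↦ ?_)))
      change τ < (boostedKerrBackground (Λf k) 0 (M k) (a k)).time y.1 - s₀ k ∧
          (boostedKerrBackground (Λf k) 0 (M k) (a k)).radius y.1 ≤ Rd ↔
        τ + s₀ k < (boostedKerrBackground (Λf k) 0 (M k) (a k)).time y.1 ∧
          (boostedKerrBackground (Λf k) 0 (M k) (a k)).radius y.1 ≤ Rd
      rw [lt_sub_iff_add_lt]
    have hmonoTLR : ∀ (k : Fin N) (σ σ' : ℝ), σ ≤ σ' →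
        (boostedKerrBackground (Λf k) 0 (M k) (a k)).truncLateRegion σ' Rd ⊆
          (boostedKerrBackground (Λf k) 0 (M k) (a k)).truncLateRegion σ Rd := by
      intro k σ σ' h y hy
      rw [ModelBackground.mem_truncLateRegion] at hy ⊢
      exact ⟨h.trans_lt hy.1, hy.2⟩
    have hev := eventually_disjoint_truncLateRegion_images 𝒟.toSpacetime i j M a ξ U Φ (τ₀ := τ₀)
      (fun x hx x' hx' h ↦ hinj x x' hx hx' h) (Λf i) (Λf j) (γ := γ') (P := 4 * γ' + (4 * γ') ^ 2) hγ0
      (by positivity) (hAU i) (hAU j) (hlate₀ i) (hlate₀ j) (fun σ τ h ↦ by have := hT₀lo i σ τ h; linarith)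
      (htop i) (hwin i) (hCle i) (hCle j) (hC0 i) (hoff i) (hoff j) (hsep i j hij) Rd
    set m : ℝ := min (s₀ i) (s₀ j) with hm
    have hev' := (tendsto_atTop_add_const_right atTop m tendsto_id).eventually hev
    refine hev'.mono fun τ hτ ↦ ?_
    rw [himg i τ, himg j τ]
    exact Disjoint.mono
      (Set.image_mono (hmonoTLR i _ _ (by show τ + m ≤ τ + s₀ i; linarith [min_le_left (s₀ i) (s₀ j)])))
      (Set.image_mono (hmonoTLR j _ _ (by show τ + m ≤ τ + s₀ j; linarith [min_le_right (s₀ i) (s₀ j)])))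
      hτ
  -- ### the flat side in the assembly's vocabulary
  have htube' : {x : E4 | τ₀' < x 0 ∧ ∀ i, ρ i (x 0) <
      Kerr.radius (a i) (poincareInv (Λf i) (cm i) x)} ⊆ (U₀ : Set E4) := by
    intro x hx
    refine htube ⟨by linarith [hx.1], fun i ↦ ?_⟩
    have h := hx.2 i
    have h1 : Kerr.radius (a i) (poincareInv (Λf i) (cm i) x) = Kerr.radius (a i) (poincareInv (Λf i) 0 x) := by
      have e1 := lag_radius (Λf i) (s₀ i) (M i) (a i) x
      have e2 := (boosted_time_radius (Λf i) (M i) (a i) x).2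
      exact e1.trans e2.symm
    rw [h1] at h; exact h
  have hflatemb' : IsOpenEmbedding (((Minkowski.backgroundOn U₀).lateRegion τ₀').restrict
      (Φ ∘ Opens.inclusion hU₀)) :=
    isOpenEmbedding_restrict_lateRegion_of_le' Bf (fun _ ↦ rfl) hemb hU₀ hτ.le
  have hU₀E : ∀ x : U₀, τ₀' < x.1 0 → ∀ j, Kerr.rPlus (M j) (a j) < Kerr.radius (a j)
      (poincareInv (Λ j ((Opens.inclusion hU₀ x).1 0)) (E4.ofTimeSpace ((Opens.inclusion hU₀ x).1 0)
        (ξ j ((Opens.inclusion hU₀ x).1 0))) (Opens.inclusion hU₀ x).1) := by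
    intro x _ j
    have hx : (x.1 : E4) ∈ (U₀ : Set E4) := x.2
    rw [hU₀eq] at hx
    have h1 := hx.2 j
    have h2 := sub_abs_le_radius_poincareInv (Λ j (x.1 0)) (a j) (x := (x.1 : E4)) rfl (ξ j (x.1 0))
    have h3 : |a j| ≤ ∑ k, |a k| := Finset.single_le_sum (f := fun k ↦ |a k|) (fun _ _ ↦ abs_nonneg _) (Finset.mem_univ j)
    have h4 : Kerr.rPlus (M j) (a j) ≤ ∑ k, Kerr.rPlus (M k) (a k) :=
      Finset.single_le_sum (f := fun k ↦ Kerr.rPlus (M k) (a k)) (fun k _ ↦ (hrp0 k).le) (Finset.mem_univ j)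
    have h5 : 0 ≤ ∑ k, |rin k| := Finset.sum_nonneg fun k _ ↦ abs_nonneg _
    have h6 := hR'R₀ (x.1 0)
    change R' (x.1 0) < _ at h1
    show Kerr.rPlus (M j) (a j) < Kerr.radius (a j) (poincareInv (Λ j (x.1 0)) (E4.ofTimeSpace (x.1 0) (ξ j (x.1 0))) x.1)
    linarith
  have hAlate' : ∀ (i : Fin N) (y : (boostedKerrBackground (Λf i) (cm i) (M i) (a i)).domain),
      τ₀ < A' i y.1 0 ∧ ∀ j, Kerr.rPlus (M j) (a j) < Kerr.radius (a j)
        (poincareInv (Λ j ((⟨A' i y.1, hAU' i y.1 y.2⟩ : U).1 0)) (E4.ofTimeSpace ((⟨A' i y.1, hAU' i y.1 y.2⟩ : U).1 0)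
          (ξ j ((⟨A' i y.1, hAU' i y.1 y.2⟩ : U).1 0))) (⟨A' i y.1, hAU' i y.1 y.2⟩ : U).1) :=
    fun i y ↦ ⟨hlate₀ i _, hradii i _ (symm_mem_rest_of_mem_lag (Λf i) (s₀ i) (M i) (a i) y.2)⟩
  -- ### the assembly
  exact exists_finalStateDecomposition_of_rechart_spin 𝒟 M a (fun i ↦ (hsub i).1) Λf cm U Φ hΦ O
    (fun x : U ↦ ∀ j, Kerr.rPlus (M j) (a j) < Kerr.radius (a j)
      (poincareInv (Λ j (x.1 0)) (E4.ofTimeSpace (x.1 0) (ξ j (x.1 0))) x.1))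
    hτ hO himO A' hA'c hAU' hAlate' hψemb hconvR' (fun i τ ↦ Rr i (τ + s₀ i)) hRctop hRcfloor hRc hdisj U₀ hU₀ ρ hρ
    htube' hflat hflatemb' hU₀E htransfer

end Summit.FinalStateConjecture.FinalStateConjecture.Theorems
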